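import Summits.FinalStateConjecture.FinalStateConjecture.Theses.KerrnessPropagates
import Summits.FinalStateConjecture.FinalStateConjecture.Theorems.ClusterCompletenessOmegaLimitMultiKerrMotionRebase
import Summits.FinalStateConjecture.FinalStateConjecture.Theorems.EIHFluxBalanceInertialRecessionLorentz
import Literature.Geometry.Lorentzian.BoostedKerrSchildDecay

/-!
# Route `KerrnessPropagates`, crux `KerrBasinCapture` (stmt-FinalStateConjecture-17646), line `registered`
# (skeleton `Cruxes/KerrBasinCapture/Lines/birth.lean`, lead rev 5) — stub `stub_uniformBoostedKerrDecay`

**Uniform boosted Kerr–Schild decay.** The library's far-field decay of all derivatives of the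
boosted Kerr–Schild perturbation,
`Literature.Geometry.Lorentzian.norm_iteratedFDeriv_boostedKsPert_le`, gives for FIXED
`(Λ, c, M, a, m)` constants `C, R` with `‖Dᵐ (boostedKerrBilin Λ c M a − η)(x)‖ ≤ C / r`,
`r = r_a(Λ⁻¹(x − c)) ≥ R`. The line `registered` of the crux `KerrBasinCapture` transfers hand-over
slabs from a sequence of multi-Kerr configurations to their limit, so it needs these constants
UNIFORM over the compact label/boost window `m₀ ≤ M ≤ m₀⁻¹`, `|a| ≤ χ M`, `‖Λ‖ ≤ L₀` (and all
centres `c`, all orders `m ≤ k`). This file proves exactly that (`stub_uniformBoostedKerrDecay`).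

Proof (the scaling proof of the fixed-parameter statement with the boost made a parameter):

* `norm_iteratedFDeriv_boostedKsPert_one_le_uniform` — the bound `B` on
  `‖Dᵐ (boostedKerrBilin Λ 0 1 a' − η)(y)‖` over the boosted unit shell
  (`(Λ⁻¹y)⁰ = 0`, `‖(Λ⁻¹y)~‖ = 1`, `|a'| ≤ 1/2`) is uniform over `‖Λ⁻¹‖ ≤ L'`, `‖y‖ ≤ K₀`: the
  family `((M, a'), (L, c), z) ↦ (precomp L) ∘ (g_{M,a'}(L(z − c)) ∘ L) − η` is jointly smooth where
  the rest-frame radius is positive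
  (`ClusterCompleteness.contDiffAt_precomp_kerrBilin_param`), hence so are its `z`-derivatives
  (`Literature.Analysis.Calculus.contDiffAt_iteratedFDeriv_parametric`), which are therefore
  bounded on the COMPACT set
  `{M = 1, |a'| ≤ 1/2, ‖L‖ ≤ L', c = 0, ‖z‖ ≤ K₀, (Lz)⁰ = 0, ‖(Lz)~‖ = 1}` (closed and bounded in a
  finite-dimensional space), on which the radius is positive
  (`Kerr.radius_pos_of_abs_lt`);
* `norm_iteratedFDeriv_boostedKsPert_le_uniform_order` — for one order `m`: translate `x` along
  `Λe₀` to kill the rest-frame time (`iteratedFDeriv_boostedKsPert_add_smul`), rescale by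
  `ε = 1/‖z~‖` (`boostedKsPert_smul`, `norm_iteratedFDeriv_const_smul_comp_smul_le`) onto the
  boosted unit shell, where `‖Λ⁻¹‖ ≤ 1 + 3L₀` (`norm_lorentz_symm_le'`) and `‖y‖ ≤ L₀`; the factor
  `ε M ≤ m₀⁻¹ / r` gives `C = m₀⁻¹ B`, with `R₀ = 1 + 2|χ| m₀⁻¹` (so `|εa| ≤ 1/2`);
* `stub_uniformBoostedKerrDecay` — maximum of the constants over `m ≤ k`.

References: Kerr–Schild 1965, §2–§3 (Lorentz covariance and asymptotic flatness of the ansatz);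
O'Neill 1983, Ch. 9 (the Lorentz group).
-/

open scoped BigOperators Topology Manifold Classical Matrix InnerProductSpace ContinuousMap ContDiff
open Filter Set Function TopologicalSpace
open Literature.Geometry.Lorentzian

-- D-0017: single-problem summit, `Summit.<S>.<S>.…` by design.
set_option linter.dupNamespace false

namespace Summit.FinalStateConjecture.FinalStateConjecture.Theorems.KerrnessPropagates.KerrBasinCapture

/-- **Uniform bound on the boosted unit shell, uniformly in the boost.** For every order `m` and
bounds `L', K₀` there is `B` with `‖Dᵐ (boostedKerrBilin Λ 0 1 a' − η)(y)‖ ≤ B` for all Lorentz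
`Λ` with `‖Λ⁻¹‖ ≤ L'`, all `|a'| ≤ 1/2` and all `y` with `‖y‖ ≤ K₀` whose rest-frame point `Λ⁻¹y`
has time `0` and unit spatial norm (joint smoothness of the family in `(L, a', y)`, continuity of
the parametric `y`-derivatives, compactness). Kerr–Schild 1965, §3. [folklore] -/
theorem norm_iteratedFDeriv_boostedKsPert_one_le_uniform (m : ℕ) (L' K₀ : ℝ) :
    ∃ B : ℝ, ∀ Λ : lorentzGroup, ‖((Λ : E4 ≃L[ℝ] E4).symm : E4 →L[ℝ] E4)‖ ≤ L' →
      ∀ a' : ℝ, |a'| ≤ 1 / 2 → ∀ y : E4, ‖y‖ ≤ K₀ → poincareInv Λ 0 y 0 = 0 →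
      E4.spatialNorm (poincareInv Λ 0 y) = 1 →
      ‖iteratedFDeriv ℝ m (fun y ↦ boostedKerrBilin Λ 0 1 a' y - Minkowski.bilin) y‖ ≤ B := by
  -- the family `q = (((M, a'), (L, c)), z) ↦ (precomp L) ∘ (g_{M,a'}(L(z − c)) ∘ L) − η`
  set G : ((ℝ × ℝ) × ((E4 →L[ℝ] E4) × E4)) × E4 → E4 →L[ℝ] E4 →L[ℝ] ℝ := fun q ↦
    (ContinuousLinearMap.precomp ℝ q.1.2.1).comp
      ((Kerr.bilin q.1.1.1 q.1.1.2 (q.1.2.1 (q.2 - q.1.2.2))).comp q.1.2.1) - Minkowski.bilin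
    with hG
  set U : Set (((ℝ × ℝ) × ((E4 →L[ℝ] E4) × E4)) × E4) :=
    {q | 0 < Kerr.radius q.1.1.2 (q.1.2.1 (q.2 - q.1.2.2))} with hU
  have hUo : IsOpen U := ClusterCompleteness.isOpen_setOf_radius_param_pos
  have hGs : ∀ q ∈ U, ContDiffAt ℝ ∞ G q := fun q hq ↦
    (ClusterCompleteness.contDiffAt_precomp_kerrBilin_param hq).sub contDiffAt_const
  -- its parametric `z`-derivatives are continuous on `U`
  set Φ := fun q : ((ℝ × ℝ) × ((E4 →L[ℝ] E4) × E4)) × E4 ↦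
    iteratedFDeriv ℝ m (fun z ↦ G (q.1, z)) q.2 with hΦ
  have hΦc : ContinuousOn Φ U := fun q hq ↦
    (Literature.Analysis.Calculus.contDiffAt_iteratedFDeriv_parametric hGs m q
      hq).continuousAt.continuousWithinAt
  -- the compact set of configurations and points
  set K : Set (((ℝ × ℝ) × ((E4 →L[ℝ] E4) × E4)) × E4) :=
    {q | q.1.1.1 = 1 ∧ |q.1.1.2| ≤ 1 / 2 ∧ ‖q.1.2.1‖ ≤ L' ∧ q.1.2.2 = 0 ∧ ‖q.2‖ ≤ K₀ ∧
      q.1.2.1 q.2 0 = 0 ∧ E4.spatialNorm (q.1.2.1 q.2) = 1} with hK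
  have hev : Continuous fun q : ((ℝ × ℝ) × ((E4 →L[ℝ] E4) × E4)) × E4 ↦ q.1.2.1 q.2 := by
    fun_prop
  have hc0 : Continuous fun y : E4 ↦ y 0 := PiLp.continuous_apply 2 _ 0
  have hsn : Continuous E4.spatialNorm := continuous_norm.comp E4.spatial.continuous
  have hKcl : IsClosed K := by
    simp only [hK, Set.setOf_and]
    refine (isClosed_eq (by fun_prop) continuous_const).inter <|
      (isClosed_le (continuous_abs.comp (by fun_prop)) continuous_const).inter <|
      (isClosed_le (continuous_norm.comp (by fun_prop)) continuous_const).inter <|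
      (isClosed_eq (by fun_prop) continuous_const).inter <|
      (isClosed_le (continuous_norm.comp (by fun_prop)) continuous_const).inter <|
      (isClosed_eq (hc0.comp hev) continuous_const).inter
      (isClosed_eq (hsn.comp hev) continuous_const)
  have hKc : IsCompact K := by
    haveI : ProperSpace (E4 →L[ℝ] E4) := FiniteDimensional.proper ℝ (E4 →L[ℝ] E4)
    have hbig : IsCompact (((Metric.closedBall (1 : ℝ) 0 ×ˢ Metric.closedBall (0 : ℝ) (1 / 2)) ×ˢ
        (Metric.closedBall (0 : E4 →L[ℝ] E4) L' ×ˢ Metric.closedBall (0 : E4) 0)) ×ˢ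
        Metric.closedBall (0 : E4) K₀) :=
      (((isCompact_closedBall _ _).prod (isCompact_closedBall _ _)).prod
        ((isCompact_closedBall _ _).prod (isCompact_closedBall _ _))).prod
        (isCompact_closedBall _ _)
    refine hbig.of_isClosed_subset hKcl ?_
    rintro q ⟨h1, h2, h3, h4, h5, -, -⟩
    refine ⟨⟨⟨?_, ?_⟩, ⟨?_, ?_⟩⟩, ?_⟩
    · rw [Metric.mem_closedBall, h1, dist_self]
    · rwa [Metric.mem_closedBall, dist_zero_right, Real.norm_eq_abs]
    · exact mem_closedBall_zero_iff.2 h3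
    · rw [Metric.mem_closedBall, h4, dist_self]
    · exact mem_closedBall_zero_iff.2 h5
  -- on which the rest-frame radius is positive
  have hKU : K ⊆ U := by
    rintro q ⟨-, h2, -, h4, -, -, h7⟩
    show 0 < Kerr.radius q.1.1.2 (q.1.2.1 (q.2 - q.1.2.2))
    rw [h4, sub_zero]
    exact Kerr.radius_pos_of_abs_lt (by rw [h7]; linarith)
  obtain ⟨B, hB⟩ := hKc.exists_bound_of_continuousOn (hΦc.mono hKU)
  refine ⟨B, fun Λ hΛ a' ha' y hy h0 h1 ↦ ?_⟩
  have h0' : (((Λ : E4 ≃L[ℝ] E4).symm : E4 →L[ℝ] E4) y) 0 = 0 := by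
    rw [ContinuousLinearEquiv.coe_coe, ← poincareInv_zero Λ y]
    exact h0
  have h1' : E4.spatialNorm (((Λ : E4 ≃L[ℝ] E4).symm : E4 →L[ℝ] E4) y) = 1 := by
    rw [ContinuousLinearEquiv.coe_coe, ← poincareInv_zero Λ y]
    exact h1
  have hq : ((((1 : ℝ), a'), (((Λ : E4 ≃L[ℝ] E4).symm : E4 →L[ℝ] E4), (0 : E4))), y) ∈ K :=
    ⟨rfl, ha', hΛ, rfl, hy, h0', h1'⟩
  -- the member `((1, a'), (Λ⁻¹, 0))` of the family is `boostedKerrBilin Λ 0 1 a' − η` (`rfl`)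
  have hGq : ∀ z : E4, G ((((1 : ℝ), a'), (((Λ : E4 ≃L[ℝ] E4).symm : E4 →L[ℝ] E4), (0 : E4))), z) =
      boostedKerrBilin Λ 0 1 a' z - Minkowski.bilin := fun z ↦ rfl
  have key := hB _ hq
  simp only [hΦ, hGq] at key
  exact key

/-- **Uniform decay at one order.** For `m`, `m₀ > 0`, `χ`, `L₀` there is `C` with
`‖Dᵐ (boostedKerrBilin Λ c M a − η)(x)‖ ≤ C / r_a(Λ⁻¹(x − c))` whenever `m₀ ≤ M ≤ m₀⁻¹`,
`|a| ≤ χ M`, `‖Λ v‖ ≤ L₀ ‖v‖` and `r_a(Λ⁻¹(x − c)) ≥ 1 + 2|χ| m₀⁻¹`: the scaling proof of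
`norm_iteratedFDeriv_boostedKsPert_le` (stationarity along `Λe₀`, `boostedKsPert_smul` with
`ε = 1/‖z~‖`) with the uniform shell bound `norm_iteratedFDeriv_boostedKsPert_one_le_uniform`
(`‖Λ⁻¹‖ ≤ 1 + 3L₀` by `norm_lorentz_symm_le'`, `‖y‖ ≤ L₀` on the boosted unit shell).
Kerr–Schild 1965, §2–§3. [folklore] -/
theorem norm_iteratedFDeriv_boostedKsPert_le_uniform_order (m : ℕ) {m₀ : ℝ} (hm₀ : 0 < m₀)
    (χ L₀ : ℝ) :
    ∃ C : ℝ, ∀ (M a : ℝ) (Λ : lorentzGroup) (c : E4), m₀ ≤ M → M ≤ m₀⁻¹ → |a| ≤ χ * M →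
      (∀ v : E4, ‖(Λ : E4 ≃L[ℝ] E4) v‖ ≤ L₀ * ‖v‖) → ∀ x : E4,
      1 + 2 * |χ| * m₀⁻¹ ≤ Kerr.radius a (poincareInv Λ c x) →
      ‖iteratedFDeriv ℝ m (fun y ↦ boostedKerrBilin Λ c M a y - Minkowski.bilin) x‖ ≤
        C / Kerr.radius a (poincareInv Λ c x) := by
  obtain ⟨B, hB⟩ := norm_iteratedFDeriv_boostedKsPert_one_le_uniform m (1 + 3 * max L₀ 0)
    (max L₀ 0)
  refine ⟨m₀⁻¹ * max B 0, fun M a Λ c hM hM' ha hΛ x hx ↦ ?_⟩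
  set z : E4 := poincareInv Λ c x with hz
  set s := E4.spatialNorm z with hs
  have hM0 : 0 < M := hm₀.trans_le hM
  have haχ : |a| ≤ |χ| * m₀⁻¹ := by
    have h1 : χ * M ≤ |χ| * M := mul_le_mul_of_nonneg_right (le_abs_self χ) hM0.le
    have h2 : |χ| * M ≤ |χ| * m₀⁻¹ := mul_le_mul_of_nonneg_left hM' (abs_nonneg χ)
    linarith
  have hχ0 : 0 ≤ 2 * |χ| * m₀⁻¹ := by positivity
  have hr1 : 1 ≤ Kerr.radius a z := by linarith
  have hr0 : 0 < Kerr.radius a z := one_pos.trans_le hr1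
  have hrs : Kerr.radius a z ≤ s := Kerr.radius_le_spatialNorm a z
  have hs1 : 1 ≤ s := hr1.trans hrs
  have hs0 : 0 < s := one_pos.trans_le hs1
  have hsa : 2 * |a| ≤ s := by linarith
  set ε := s⁻¹ with hε
  have hε0 : 0 < ε := inv_pos.mpr hs0
  have hε1 : ε ≤ 1 := inv_le_one_of_one_le₀ hs1
  -- the inverse boost is bounded in terms of `L₀`
  have hΛsymm : ‖((Λ : E4 ≃L[ℝ] E4).symm : E4 →L[ℝ] E4)‖ ≤ 1 + 3 * max L₀ 0 := by
    refine (norm_lorentz_symm_le' Λ).trans ?_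
    have h1 : |((Λ : E4 ≃L[ℝ] E4) (E4.basisVector 0)) 0| ≤
        ‖(Λ : E4 ≃L[ℝ] E4) (E4.basisVector 0)‖ := by
      have h := PiLp.norm_apply_le ((Λ : E4 ≃L[ℝ] E4) (E4.basisVector 0)) 0
      rwa [Real.norm_eq_abs] at h
    have h2 : ‖(Λ : E4 ≃L[ℝ] E4) (E4.basisVector 0)‖ ≤ L₀ := by
      have h := hΛ (E4.basisVector 0)
      rwa [show ‖E4.basisVector 0‖ = 1 by simp [E4.basisVector], mul_one] at h
    linarith [le_max_left L₀ 0]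
  -- kill the rest-frame time coordinate by a translation along `Λe₀`
  set x' : E4 := x + (-(z 0)) • (Λ : E4 ≃L[ℝ] E4) (E4.basisVector 0) with hx'
  have hz' : poincareInv Λ c x' = z - z 0 • E4.basisVector 0 := by
    rw [hx', poincareInv, add_sub_right_comm, map_add, map_smul,
      ContinuousLinearEquiv.symm_apply_apply, neg_smul, ← sub_eq_add_neg]
    rfl
  have hder := iteratedFDeriv_boostedKsPert_add_smul Λ c M a m x (-(z 0))
  have hsp : E4.spatial (poincareInv Λ c x') = E4.spatial z := by
    have h0 : E4.spatial (E4.basisVector 0) = 0 := by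
      ext i
      simp
    rw [hz', map_sub, map_smul, h0, smul_zero, sub_zero]
  have hz'0 : poincareInv Λ c x' 0 = 0 := by
    rw [hz']
    simp
  have hrx' : Kerr.radius a (poincareInv Λ c x') = Kerr.radius a z :=
    Kerr.radius_eq_of_spatial_eq a hsp
  have hsx' : E4.spatialNorm (poincareInv Λ c x') = s := by
    rw [hs, E4.spatialNorm, E4.spatialNorm, hsp]
  -- the rescaled rest-frame point on the unit shell
  set y₁ : E4 := ε • (x' - c) with hy₁
  have hPy₁ : poincareInv Λ 0 y₁ = ε • poincareInv Λ c x' := by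
    rw [hy₁, poincareInv_zero, map_smul]
    rfl
  have hy₁0 : poincareInv Λ 0 y₁ 0 = 0 := by
    rw [hPy₁]
    simp [hz'0]
  have hy₁1 : E4.spatialNorm (poincareInv Λ 0 y₁) = 1 := by
    rw [hPy₁, Kerr.spatialNorm_smul, abs_of_pos hε0, hsx', hε, inv_mul_cancel₀ hs0.ne']
  have ha' : |ε * a| ≤ 1 / 2 := by
    rw [abs_mul, abs_of_pos hε0, hε]
    rw [inv_mul_le_iff₀ hs0]
    linarith
  -- the rescaled lab point is bounded in terms of `L₀`
  have hy₁K : ‖y₁‖ ≤ max L₀ 0 := by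
    have hw : ‖poincareInv Λ 0 y₁‖ = 1 := by
      have h := norm_sq_eq_sq_add_spatialNorm_sq (poincareInv Λ 0 y₁)
      rw [hy₁0, hy₁1, zero_pow two_ne_zero, one_pow, zero_add] at h
      exact (pow_eq_one_iff_of_nonneg (norm_nonneg _) two_ne_zero).1 h
    have hy' : y₁ = (Λ : E4 ≃L[ℝ] E4) (poincareInv Λ 0 y₁) := by
      rw [poincareInv_zero, ContinuousLinearEquiv.apply_symm_apply]
    calc ‖y₁‖ = ‖(Λ : E4 ≃L[ℝ] E4) (poincareInv Λ 0 y₁)‖ := by rw [← hy']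
      _ ≤ L₀ * ‖poincareInv Λ 0 y₁‖ := hΛ _
      _ = L₀ := by rw [hw, mul_one]
      _ ≤ max L₀ 0 := le_max_left _ _
  -- smoothness of the rescaled boosted perturbation at `ε x'`
  have hrad₁ : 0 < Kerr.radius (ε * a) (poincareInv Λ 0 (ε • x' - ε • c)) := by
    rw [← smul_sub, ← hy₁, hPy₁, Kerr.radius_smul hε0, hrx']
    exact mul_pos hε0 hr0
  have hG : ContDiffAt ℝ m
      (fun w ↦ boostedKerrBilin Λ 0 1 (ε * a) (w - ε • c) - Minkowski.bilin) (ε • x') := by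
    have h1 : ContDiffAt ℝ m (fun w ↦ boostedKerrBilin Λ 0 1 (ε * a) w - Minkowski.bilin)
        (ε • x' - ε • c) := contDiffAt_boostedKsPert hrad₁
    exact h1.comp (ε • x') (contDiffAt_id.sub contDiffAt_const)
  -- scaling of the iterated derivative
  have hfun : (fun y ↦ boostedKerrBilin Λ c M a y - Minkowski.bilin) =
      fun y ↦ (ε * M) • (fun w ↦ boostedKerrBilin Λ 0 1 (ε * a) (w - ε • c) - Minkowski.bilin)
        (ε • y) := by
    funext y
    rw [boostedKsPert_smul Λ hε0 c M a y, smul_sub]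
  have hkey := norm_iteratedFDeriv_const_smul_comp_smul_le
    (fun w ↦ boostedKerrBilin Λ 0 1 (ε * a) (w - ε • c) - Minkowski.bilin) (ε * M) hε0.ne' x'
    (m := m) hG
  have htrans : iteratedFDeriv ℝ m
      (fun w ↦ boostedKerrBilin Λ 0 1 (ε * a) (w - ε • c) - Minkowski.bilin) (ε • x') =
      iteratedFDeriv ℝ m (fun y ↦ boostedKerrBilin Λ 0 1 (ε * a) y - Minkowski.bilin) y₁ := by
    rw [iteratedFDeriv_comp_sub (f := fun y ↦ boostedKerrBilin Λ 0 1 (ε * a) y - Minkowski.bilin)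
      m (ε • c) (ε • x'), hy₁, smul_sub]
  have hεm : ε ^ m ≤ 1 := pow_le_one₀ hε0.le hε1
  have hB0 : 0 ≤ max B 0 := le_max_right _ _
  have hBy : ‖iteratedFDeriv ℝ m (fun y ↦ boostedKerrBilin Λ 0 1 (ε * a) y - Minkowski.bilin)
      y₁‖ ≤ max B 0 := (hB Λ hΛsymm _ ha' y₁ hy₁K hy₁0 hy₁1).trans (le_max_left _ _)
  have hεM : |ε * M| * |ε| ^ m ≤ ε * M * 1 := by
    rw [abs_mul, abs_of_pos hε0, abs_of_pos hM0]
    exact mul_le_mul_of_nonneg_left hεm (mul_pos hε0 hM0).le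
  have hfin : ε * M * 1 * max B 0 ≤ m₀⁻¹ * max B 0 / Kerr.radius a z := by
    rw [mul_one, div_eq_inv_mul, ← mul_assoc]
    refine mul_le_mul_of_nonneg_right ?_ hB0
    exact mul_le_mul (inv_anti₀ hr0 hrs) hM' hM0.le (inv_nonneg.2 hr0.le)
  rw [← hder, hfun]
  refine hkey.trans ?_
  rw [htrans]
  exact (mul_le_mul hεM hBy (norm_nonneg _) (mul_pos (mul_pos hε0 hM0) one_pos).le).trans hfin

/-- stub G — **UNIFORM BOOSTED KERR–SCHILD DECAY** (registered stub of crux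
stmt-FinalStateConjecture-17646, line `registered`). For every order `k`, mass floor `m₀ > 0`,
spin ratio `χ` and boost bound `L₀` there are `C` and `R₀ > 0` such that for all labels
`m₀ ≤ M ≤ m₀⁻¹`, `|a| ≤ χ M`, all Lorentz `Λ` with `‖Λ v‖ ≤ L₀ ‖v‖`, all centres `c` and all `x`
with rest-frame Kerr–Schild radius `r = r_a(Λ⁻¹(x − c)) ≥ R₀`, every derivative of order `m ≤ k`
of the boosted Kerr–Schild perturbation satisfies
`‖Dᵐ (boostedKerrBilin Λ c M a − η)(x)‖ ≤ C / r` (maximum over `m ≤ k` of the constants of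
`norm_iteratedFDeriv_boostedKsPert_le_uniform_order`, `R₀ = 1 + 2|χ| m₀⁻¹`). Kerr–Schild 1965,
§2–§3. [folklore] -/
theorem stub_uniformBoostedKerrDecay : ∀ (k : ℕ) (m₀ χ L₀ : ℝ), 0 < m₀ → ∃ C R₀ : ℝ, 0 < R₀ ∧ ∀ (M a : ℝ) (Λ : ↥lorentzGroup) (c : E4), m₀ ≤ M → M ≤ m₀⁻¹ → |a| ≤ χ * M → (∀ v : E4, ‖(Λ : E4 ≃L[ℝ] E4) v‖ ≤ L₀ * ‖v‖) → ∀ x : E4, R₀ ≤ Kerr.radius a (poincareInv Λ c x) → ∀ m ≤ k, ‖iteratedFDeriv ℝ m (fun y ↦ boostedKerrBilin Λ c M a y - Minkowski.bilin) x‖ ≤ C / Kerr.radius a (poincareInv Λ c x) := by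
  intro k m₀ χ L₀ hm₀
  -- one constant for all orders `m ≤ k` (maximum of the per-order constants)
  have main : ∃ C : ℝ, ∀ m ≤ k, ∀ (M a : ℝ) (Λ : lorentzGroup) (c : E4), m₀ ≤ M → M ≤ m₀⁻¹ →
      |a| ≤ χ * M → (∀ v : E4, ‖(Λ : E4 ≃L[ℝ] E4) v‖ ≤ L₀ * ‖v‖) → ∀ x : E4,
      1 + 2 * |χ| * m₀⁻¹ ≤ Kerr.radius a (poincareInv Λ c x) →
      ‖iteratedFDeriv ℝ m (fun y ↦ boostedKerrBilin Λ c M a y - Minkowski.bilin) x‖ ≤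
        C / Kerr.radius a (poincareInv Λ c x) := by
    induction k with
    | zero =>
      obtain ⟨C, hC⟩ := norm_iteratedFDeriv_boostedKsPert_le_uniform_order 0 hm₀ χ L₀
      exact ⟨C, fun m hm ↦ by rw [Nat.le_zero.1 hm]; exact hC⟩
    | succ k ih =>
      obtain ⟨C, hC⟩ := ih
      obtain ⟨C', hC'⟩ := norm_iteratedFDeriv_boostedKsPert_le_uniform_order (k + 1) hm₀ χ L₀
      refine ⟨max C C', fun m hm M a Λ c hM hM' ha hΛ x hx ↦ ?_⟩
      have hχ0 : 0 ≤ 2 * |χ| * m₀⁻¹ := by positivity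
      have hr0 : 0 < Kerr.radius a (poincareInv Λ c x) := by linarith
      rcases Nat.of_le_succ hm with h | h
      · exact (hC m h M a Λ c hM hM' ha hΛ x hx).trans
          (div_le_div_of_nonneg_right (le_max_left _ _) hr0.le)
      · rw [h]
        exact (hC' M a Λ c hM hM' ha hΛ x hx).trans
          (div_le_div_of_nonneg_right (le_max_right _ _) hr0.le)
  obtain ⟨C, hC⟩ := main
  refine ⟨C, 1 + 2 * |χ| * m₀⁻¹, by positivity, fun M a Λ c hM hM' ha hΛ x hx m hm ↦ ?_⟩
  exact hC m hm M a Λ c hM hM' ha hΛ x hx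

end Summit.FinalStateConjecture.FinalStateConjecture.Theorems.KerrnessPropagates.KerrBasinCapture
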